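import Literature.AnabelianGeometry.AbsoluteAnabelian.AbsTopIII.FrobeniusPictureMLFTelecoreIncompatibility
import Mathlib.CategoryTheory.SingleObj
import Mathlib.CategoryTheory.PUnit
import Mathlib.Algebra.Group.Nat.TypeTags
import HarnessLib

/-!
# [AbsTopIII] Lemma 3.4 as the schema `LogFrobeniusData.Lemma34Property` (FACT-LIST F-0364):
# the universal closure is REFUTABLE; the consumed instance is proved at the model

S. Mochizuki, *Topics in absolute anabelian geometry III: global reconstruction algorithms*,
J. Math. Sci. Univ. Tokyo 22 (2015) [MochizukiAbsTopIII2015]; manuscript pages (`paper:url-5493eb38cbb7`):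
Lemma 3.4 p. 74, used in the proof of Cor. 3.6 (iv) pp. 81–82.

PROOF-ONLY negative-knowledge file (no definition, no instance) next to
`AbsTopIII/FrobeniusPictureMLFTelecoreIncompatibility.lean` (abc-iut-L4-t5), abc-iut cell seat abc-iut-f-003
(FACT-LIST row **F-0364**, class `preparatory`, kernel_closedness `parametrised`).

`LogFrobeniusData.Lemma34Property (ι)` is a PREDICATE on ABSTRACT input data `Δ : LogFrobeniusData` of
Cor. 3.6 together with a candidate `ι_× : λ^× ⟶ λ^{×pf}`: "for every first-row object `x` and every
isomorphism `a : id_{⋎+1}(x) ⥲ id_⋎(log x)`, `λ^×(a) ≫ ι_{log,⋎}(x) ≠ ι_×(x)`".  Print asserts this ONLY for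
the MLF-Galois data of Def. 3.1 (there it is Lemma 3.4: the left side lands in `(𝒪_k^×)^pf`, the right side
does not on `𝒪_k^▷`), and that instance IS proved in the tree:
`AbsTopIII.TFModel.lemma34Property_model` (`AbsTopIII/FrobeniusPictureMLFModel.lean`, abc-iut-L4-t5/t9),
consumed by `incompatibleStmt_model` / `telecoreIncompatibleStmt_model` (Cor. 3.6 (iv) at the model).

This file supplies the kernel object saying that the UNIVERSAL closure over all abstract data is false
(`exists_not_lemma34Property`, `not_forall_lemma34Property`): at the one-object datum (all categories the
one-object discrete category except `𝒩 :=` the one-object category of the monoid `(ℕ,+)`, `log = id`,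
`λ^× = λ^{×pf}` constant) with `ι_log := 1` and `ι_× := 1`, the identity `a = id` gives
`λ^×(a) ≫ ι_log = 0 + 1 = 1 = ι_×`.  So F-0364 is admissible ONLY in its instance form at the MLF-Galois
model (FACT-LIST class «universal-closure REFUTED; instance form PROVED»), never as the closed schema —
in particular the schema must not appear as a hypothesis binder of a conditional certificate (it would
make the certificate vacuous).  Refereed pre-IUT material; nothing here bears on [IUTchIII] Cor. 3.12 or
takes a side; refuted-as-schema is not a defect of print, whose statement is the instance.
-/

namespace Literature.AnabelianGeometry.AbsoluteAnabelian.LogFrobeniusData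

open _root_.CategoryTheory

/-- **F-0364 as a schema is false at an explicit datum**: there is an abstract log-Frobenius input datum
`Δ` (one-object categories; `𝒩` the monoid `(ℕ,+)`; `ι_log = 1`) and a candidate `ι_× := 1 : λ^× ⟶ λ^{×pf}`
for which the Lemma-3.4 property FAILS — the identity isomorphism `a = id_x` gives
`λ^×(a) ≫ ι_log(x) = 1 = ι_×(x)`.  (Print's Lemma 3.4 concerns the MLF-Galois data only, where the property
holds: `AbsTopIII.TFModel.lemma34Property_model`.) [cite: MochizukiAbsTopIII2015, Lemma 3.4 p.74] -/
theorem exists_not_lemma34Property :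
    ∃ (Δ : LogFrobeniusData.{0}) (ι : Δ.lamTimes ⟶ Δ.lamPf),
      ¬ Literature.AnabelianGeometry.AbsoluteAnabelian.LogFrobeniusData.Lemma34Property ι := by
  -- the one-object categories: `P` (discrete) for `𝒳`, `ℰ`, `𝒜` and `N` (monoid `(ℕ,+)`) for `𝒩`
  let L : Discrete PUnit.{1} ⥤ SingleObj (Multiplicative ℕ) :=
    (Functor.const (Discrete PUnit.{1})).obj (SingleObj.star _)
  -- `ι_log = 1` and `ι_× = 1 : λ^× → λ^{×pf}`
  let one : L ⟶ L := Discrete.natTrans fun _ => (Multiplicative.ofAdd (1 : ℕ) : Multiplicative ℕ)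
  let Δ : LogFrobeniusData.{0} :=
    { X₁ := Discrete PUnit.{1}, X := Discrete PUnit.{1}, toNexus := 𝟭 _, N := SingleObj (Multiplicative ℕ),
      E := Discrete PUnit.{1}, A := Discrete PUnit.{1},
      log := 𝟭 _, logIsoId := Iso.refl _,
      lamTimes := L, lamPf := L,
      ιlog := one, ιtimes := Sum.inl one,
      XtoE := 𝟭 _, NtoE := (Functor.const (SingleObj (Multiplicative ℕ))).obj ⟨PUnit.unit⟩,
      lamTimes_NtoE := Functor.punit_ext' _ _, lamPf_NtoE := Functor.punit_ext' _ _,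
      κ := 𝟭 _, AtoE := 𝟭 _, κ_equiv := inferInstance, κ_inv := Functor.punitExt _ _,
      φ := 𝟭 _, φ_equiv := inferInstance, η := Functor.punitExt _ _ }
  refine ⟨Δ, one, fun h => ?_⟩
  -- the identity of the unique object is an isomorphism `id_{⋎+1}(x) ⥲ id_⋎(log x)` (`log = id`)
  refine h ⟨PUnit.unit⟩ (𝟙 _) inferInstance ?_
  -- `λ^×(id) ≫ ι_log = 1 = ι_×`
  simp [Δ, L, one, SingleObj.comp_as_mul, SingleObj.id_as_one, Discrete.natTrans]

/-- **FACT-LIST F-0364, universal closure REFUTED** (fully quantified form, universe `0`): it is NOT the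
case that every abstract log-Frobenius input datum with every candidate `ι_×` has the Lemma-3.4 property.
The admissible form of the row is the instance at the MLF-Galois model,
`AbsTopIII.TFModel.lemma34Property_model`. [cite: MochizukiAbsTopIII2015, Lemma 3.4 p.74] -/
theorem not_forall_lemma34Property :
    ¬ ∀ (Δ : LogFrobeniusData.{0}) (ι : Δ.lamTimes ⟶ Δ.lamPf),
      Literature.AnabelianGeometry.AbsoluteAnabelian.LogFrobeniusData.Lemma34Property ι := by
  obtain ⟨Δ, ι, h⟩ := exists_not_lemma34Property
  exact fun H => h (H Δ ι)

end Literature.AnabelianGeometry.AbsoluteAnabelian.LogFrobeniusData
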